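import Literature.AlgebraicGeometry.ShimuraVarieties.UnitaryBallQuotientKaehlerPullback
import HarnessLib

/-!
# The Kähler class system of the levels below a pinned compact ball quotient

Layer `Literature/AlgebraicGeometry/ShimuraVarieties`; sequel of `UnitaryBallQuotientKaehlerPullback`
(`exists_kaehlerRationalDatum_pull`: the pinned Kähler–rational datum `K` of a compact ball quotient `X`, whose
pull-backs along morphisms over translations of the ball are Kähler and independent of the morphism). PROVED here
(theorems only; no definitions, no named facts) — the bookkeeping that turns the pin into a CLASS SYSTEM on the levels
below it:

* `UnitaryBallUniformisationDatum.map_comp_unif` — junctions compose: if `t : X₁ ⟶ X₂` lies over `v ↦ γ v` and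
  `f₂ : X₂ ⟶ X` over `v ↦ g₂ v` (on the negative cones), then `t ≫ f₂` lies over `v ↦ (g₂ γ) v`;
* `UnitaryBallUniformisationDatum.map_conj_mul_le` — conjugations compose: `γ Γ₁ γ⁻¹ ≤ Γ₂`, `g₂ Γ₂ g₂⁻¹ ≤ Γ` give
  `(g₂γ) Γ₁ (g₂γ)⁻¹ ≤ Γ` (read in `GL₃(ℂ)`);
* **`UnitaryBallUniformisationDatum.exists_kaehlerClassSystem_below`** — for a compact ball-quotient datum `𝒟` on
  `X` (`p = 2`) there is `K : KaehlerRationalDatum 2 X` with (i) `f^*(K.η ⊗ 1)` Kähler and (ii) `f^* K.η = f'^* K.η`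
  as in `exists_kaehlerRationalDatum_pull`, AND (iii) for two levels `X₁`, `X₂` below `X` (morphisms `f₁ : X₁ ⟶ X`
  over `g₁`, `f₂ : X₂ ⟶ X` over `g₂`) and a morphism `t : X₁ ⟶ X₂` over `γ` (all translations in `U(H^{τ₁})`
  conjugating the groups accordingly): `t^*(f₂^* K.η) = f₁^* K.η`. With `ω_{X_i} := f_i^* K.η` this is the
  compatibility `t^* ω_{X₂} = ω_{X₁}` of the Kähler classes along level coverings (`γ = 1`) and Hecke translates
  (`γ = γ^{ι₁}`) between any two levels below the pin (Shimura 1971 §7.2–7.3).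

## References

* G. Shimura, *Introduction to the Arithmetic Theory of Automorphic Functions* (1971), §3.1 Prop. 3.1, §7.2–7.3. [Shimura1971]
* C. Voisin, *Hodge Theory and Complex Algebraic Geometry I* (2002), §3.1.3, §3.3.2 Lemma 3.16, §7.1.2. [VoisinHodgeI2002]
* N. Bergeron, J. Millson, C. Moeglin, *Hodge type theorems for arithmetic manifolds associated to orthogonal
  groups* / ball quotient conventions, Part 2 §§1.1–1.4. [BergeronMillsonMoeglin2016Balls]

## Provenance

hodgecm-mathlib cell, typer seat B-typ03 (row B3-25 (b2), tower edition, consumer-side bookkeeping).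
Everything here is kernel-checked; no named facts.
-/

set_option autoImplicit false

noncomputable section

open scoped Matrix
open CategoryTheory Matrix
open Literature.AlgebraicGeometry.Motives (SchemeOver ComplexPoints AlgPoints)
open Literature.AlgebraicGeometry.HodgeTheory (IsKaehlerClass ofRatClass KaehlerRationalDatum)
open Literature.AlgebraicGeometry.HodgeTheory.BettiUniverse (pull pull_comp)

namespace Literature.AlgebraicGeometry.ShimuraVarieties

namespace UnitaryBallUniformisationDatum

variable {X X₁ X₂ : SchemeOver ℂ} (D : UnitaryBallUniformisationDatum 2 X)
  (D₁ : UnitaryBallUniformisationDatum 2 X₁) (D₂ : UnitaryBallUniformisationDatum 2 X₂)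

/-- **Junctions compose.** If `t(ℂ)(unif₁ v) = unif₂ (γ v)` on the cone of `𝒟₁` and `f₂(ℂ)(unif₂ w) = unif (g₂ w)`
on the cone of `𝒟₂` (`γ ∈ U(H^{τ₁})`, all three data with the same Gram matrix), then
`(t ≫ f₂)(ℂ)(unif₁ v) = unif ((g₂ γ) v)`. [cite: Shimura1971, §7.2–7.3] [cite: BergeronMillsonMoeglin2016Balls, Part 2 §1.3] -/
theorem map_comp_unif (hH₁ : D₁.Hℂ = D.Hℂ) (hH₂ : D₂.Hℂ = D.Hℂ) {γ g₂ : GL (Fin 3) ℂ} (hγ : γ ∈ D.realPoints)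
    (t : X₁ ⟶ X₂) (f₂ : X₂ ⟶ X)
    (ht : ∀ v ∈ D₁.cone, AlgPoints.map t (D₁.unif v) = D₂.unif ((γ : Matrix (Fin 3) (Fin 3) ℂ) *ᵥ v))
    (hf₂ : ∀ v ∈ D₂.cone, AlgPoints.map f₂ (D₂.unif v) = D.unif ((g₂ : Matrix (Fin 3) (Fin 3) ℂ) *ᵥ v)) :
    ∀ v ∈ D₁.cone, AlgPoints.map (t ≫ f₂) (D₁.unif v) =
      D.unif (((g₂ * γ : GL (Fin 3) ℂ) : Matrix (Fin 3) (Fin 3) ℂ) *ᵥ v) := by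
  intro v hv
  have hv₂ : (γ : Matrix (Fin 3) (Fin 3) ℂ) *ᵥ v ∈ D₂.cone := by
    have hγ₂ : γ ∈ D₂.realPoints := by rw [realPoints, hH₂]; exact hγ
    have hv' : v ∈ D₂.cone := by rw [cone, hH₂, ← hH₁]; exact hv
    exact ConeChart.mulVec_mem_negCone hγ₂ hv'
  rw [AlgPoints.map_comp_apply, ht v hv, hf₂ _ hv₂, Units.val_mul, ← mulVec_mulVec]

omit D D₁ D₂ in
/-- **Conjugations compose** (read in `GL₃(ℂ)`): `γ Γ₁^{τ₁} γ⁻¹ ≤ Γ₂^{τ₁}` and `g₂ Γ₂^{τ₁} g₂⁻¹ ≤ Γ^{τ₁}` give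
`(g₂γ) Γ₁^{τ₁} (g₂γ)⁻¹ ≤ Γ^{τ₁}`. [cite: Shimura1971, §3.1 Prop. 3.1] -/
theorem map_conj_mul_le {A B C : Subgroup (GL (Fin 3) ℂ)} {γ g₂ : GL (Fin 3) ℂ}
    (h₁ : A.map (MulAut.conj γ).toMonoidHom ≤ B) (h₂ : B.map (MulAut.conj g₂).toMonoidHom ≤ C) :
    A.map (MulAut.conj (g₂ * γ)).toMonoidHom ≤ C := by
  have hcomp : (MulAut.conj (g₂ * γ)).toMonoidHom =
      (MulAut.conj g₂).toMonoidHom.comp (MulAut.conj γ).toMonoidHom := by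
    ext x
    simp [mul_assoc]
  rw [hcomp, ← Subgroup.map_map]
  exact (Subgroup.map_mono h₁).trans h₂

/-- **The Kähler class system of the levels below a pin.** For a compact ball-quotient datum `𝒟` on `X` there is
a Kähler–rational datum `K` of `X` such that, for data `𝒟₁` on `X₁`, `𝒟₂` on `X₂` with the Gram matrix of `𝒟` and
morphisms lying over translations `v ↦ g v` of the negative cone by elements `g ∈ U(H^{τ₁})` conjugating the
groups accordingly: (i) `f^*(K.η ⊗ 1)` is a Kähler class of `X₁` for every such `f : X₁ ⟶ X`; (ii) `f^* K.η = f'^* K.η`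
for any two such `f, f' : X₁ ⟶ X`; (iii) `t^*(f₂^* K.η) = f₁^* K.η` for such `f₁ : X₁ ⟶ X`, `f₂ : X₂ ⟶ X` and
`t : X₁ ⟶ X₂` — i.e. `X_i ↦ ω_{X_i} := f_i^* K.η` is a system of rational Kähler classes on the levels below `X`
compatible with every morphism over a translation between them (level coverings, Hecke translates).
[cite: Shimura1971, §3.1 Prop. 3.1, §7.2–7.3] [cite: VoisinHodgeI2002, §3.1.3, §3.3.2 Lemma 3.16 and §7.1.2] -/
theorem exists_kaehlerClassSystem_below :
    ∃ K : KaehlerRationalDatum 2 X,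
      (∀ {X₁ : SchemeOver ℂ} (D₁ : UnitaryBallUniformisationDatum 2 X₁) (_ : D₁.Hℂ = D.Hℂ)
          {g : GL (Fin 3) ℂ} (_ : g ∈ D.realPoints)
          (_ : (D₁.Γ.map (Matrix.GeneralLinearGroup.map D₁.τ₁)).map (MulAut.conj g).toMonoidHom ≤
            D.Γ.map (Matrix.GeneralLinearGroup.map D.τ₁))
          (f : X₁ ⟶ X)
          (_ : ∀ v ∈ D₁.cone, AlgPoints.map f (D₁.unif v) = D.unif ((g : Matrix (Fin 3) (Fin 3) ℂ) *ᵥ v)),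
          IsKaehlerClass 2 X₁ (ofRatClass (ComplexPoints X₁) 2 (pull f 2 K.η))) ∧
      (∀ {X₁ : SchemeOver ℂ} (D₁ : UnitaryBallUniformisationDatum 2 X₁) (_ : D₁.Hℂ = D.Hℂ)
          {g g' : GL (Fin 3) ℂ} (_ : g ∈ D.realPoints) (_ : g' ∈ D.realPoints)
          (_ : (D₁.Γ.map (Matrix.GeneralLinearGroup.map D₁.τ₁)).map (MulAut.conj g).toMonoidHom ≤
            D.Γ.map (Matrix.GeneralLinearGroup.map D.τ₁))
          (_ : (D₁.Γ.map (Matrix.GeneralLinearGroup.map D₁.τ₁)).map (MulAut.conj g').toMonoidHom ≤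
            D.Γ.map (Matrix.GeneralLinearGroup.map D.τ₁))
          (f f' : X₁ ⟶ X)
          (_ : ∀ v ∈ D₁.cone, AlgPoints.map f (D₁.unif v) = D.unif ((g : Matrix (Fin 3) (Fin 3) ℂ) *ᵥ v))
          (_ : ∀ v ∈ D₁.cone, AlgPoints.map f' (D₁.unif v) = D.unif ((g' : Matrix (Fin 3) (Fin 3) ℂ) *ᵥ v)),
          pull f 2 K.η = pull f' 2 K.η) ∧
      ∀ {X₁ X₂ : SchemeOver ℂ} (D₁ : UnitaryBallUniformisationDatum 2 X₁) (D₂ : UnitaryBallUniformisationDatum 2 X₂)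
          (_ : D₁.Hℂ = D.Hℂ) (_ : D₂.Hℂ = D.Hℂ) {γ g₁ g₂ : GL (Fin 3) ℂ} (_ : γ ∈ D.realPoints)
          (_ : g₁ ∈ D.realPoints) (_ : g₂ ∈ D.realPoints)
          (_ : (D₁.Γ.map (Matrix.GeneralLinearGroup.map D₁.τ₁)).map (MulAut.conj γ).toMonoidHom ≤
            D₂.Γ.map (Matrix.GeneralLinearGroup.map D₂.τ₁))
          (_ : (D₁.Γ.map (Matrix.GeneralLinearGroup.map D₁.τ₁)).map (MulAut.conj g₁).toMonoidHom ≤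
            D.Γ.map (Matrix.GeneralLinearGroup.map D.τ₁))
          (_ : (D₂.Γ.map (Matrix.GeneralLinearGroup.map D₂.τ₁)).map (MulAut.conj g₂).toMonoidHom ≤
            D.Γ.map (Matrix.GeneralLinearGroup.map D.τ₁))
          (t : X₁ ⟶ X₂) (f₁ : X₁ ⟶ X) (f₂ : X₂ ⟶ X)
          (_ : ∀ v ∈ D₁.cone, AlgPoints.map t (D₁.unif v) = D₂.unif ((γ : Matrix (Fin 3) (Fin 3) ℂ) *ᵥ v))
          (_ : ∀ v ∈ D₁.cone, AlgPoints.map f₁ (D₁.unif v) = D.unif ((g₁ : Matrix (Fin 3) (Fin 3) ℂ) *ᵥ v))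
          (_ : ∀ v ∈ D₂.cone, AlgPoints.map f₂ (D₂.unif v) = D.unif ((g₂ : Matrix (Fin 3) (Fin 3) ℂ) *ᵥ v)),
          pull t 2 (pull f₂ 2 K.η) = pull f₁ 2 K.η := by
  obtain ⟨K, hKi, hKii⟩ := D.exists_kaehlerRationalDatum_pull
  refine ⟨K, hKi, hKii, fun D₁ D₂ hH₁ hH₂ γ g₁ g₂ hγ hg₁ hg₂ hΓt hΓ₁ hΓ₂ t f₁ f₂ ht hf₁ hf₂ ↦ ?_⟩
  rw [← LinearMap.comp_apply, ← pull_comp]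
  exact hKii D₁ hH₁ (mul_mem hg₂ hγ) hg₁ (map_conj_mul_le hΓt hΓ₂) hΓ₁ (t ≫ f₂) f₁
    (D.map_comp_unif D₁ D₂ hH₁ hH₂ hγ t f₂ ht hf₂) hf₁

end UnitaryBallUniformisationDatum

end Literature.AlgebraicGeometry.ShimuraVarieties

end
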